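import Literature.NumberTheory.LFunctions.SemimultiplicativeMoebiusKatai
import HarnessLib

/-!
# The Kátai–Bourgain–Sarnak–Ziegler criterion, II: the bilinear step (fixed `N`)

Topic `Literature/NumberTheory/LFunctions`. Everything in this file is PROVED. Continuing
`SemimultiplicativeMoebiusKatai.lean`, we carry out Kátai's argument (Kátai 1986; used as
Theorem 2.1 in Konieczny 2020) at a FIXED length `N`, for a fixed finite set `𝓟` of primes all
exceeding `P₁ ≥ 1`, a `1`-bounded `F : ℕ → ℂ` and a `1`-bounded `ν : ℕ → ℂ` satisfying
`ν(pm) = ν(p) ν(m)` for primes `p ∤ m` (all that is used of multiplicativity):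

* `Konieczny.katai_fixed_length` — with `A = ∑_{p∈𝓟} 1/p`, `P = #𝓟`, `S = ∑_{n<N} F(n) ν(n)` and
  `η ≥ 0` such that `‖∑_{m : pm, p'm < N} F(pm) conj F(p'm)‖ ≤ η N` for all `p ≠ p'` in `𝓟`:
  `A ‖S‖ ≤ √(N (2NA + 4P²)) + (2NA/P₁ + 4P) + √(N (NA + P + P² η N))`.

The three terms are: Turán–Kubilius (`A S ≈ ∑ F ν ω`), the passage `ν(pm) → ν(p)ν(m)` (the
multiples of `p²`), and Cauchy–Schwarz in the cofactor `m` followed by the expansion of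
`|∑_p ν(p) F(pm)|²` into diagonal and off-diagonal (bilinear) terms.  The limit argument is in
`SemimultiplicativeMoebiusKataiCriterion.lean`.
-/

noncomputable section

open Finset
open scoped ComplexConjugate

namespace Literature.NumberTheory.LFunctions

namespace Konieczny

/-! ## Step 1: Turán–Kubilius, `A S ≈ ∑ F ν ω` -/

/-- `‖A ∑_{n<N} G(n) - ∑_{n<N} ω(n) G(n)‖ ≤ √(N(2NA + 4P²))` for `‖G‖ ≤ 1`.
[cite: Katai1986, proof of the Theorem] -/
theorem norm_A_mul_sum_sub_le (𝓟 : Finset ℕ) (h𝓟 : ∀ p ∈ 𝓟, p.Prime) {G : ℕ → ℂ}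
    (hG : ∀ n, ‖G n‖ ≤ 1) (N : ℕ) :
    ‖(↑(∑ p ∈ 𝓟, (1 / p : ℝ)) : ℂ) * ∑ n ∈ range N, G n -
        ∑ n ∈ range N, ((#(𝓟.filter (· ∣ n)) : ℝ) : ℂ) * G n‖ ≤
      Real.sqrt (N * (2 * N * (∑ p ∈ 𝓟, (1 / p : ℝ)) + 4 * (#𝓟 : ℝ) ^ 2)) := by
  rw [mul_sum, ← sum_sub_distrib]
  refine (norm_sum_le _ _).trans (le_trans ?_ (sum_abs_omega_sub_le 𝓟 h𝓟 N))
  refine sum_le_sum fun n _ => ?_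
  rw [← sub_mul, norm_mul, ← Complex.ofReal_sub, Complex.norm_real, Real.norm_eq_abs,
    abs_sub_comm]
  calc _ ≤ |(#(𝓟.filter (· ∣ n)) : ℝ) - (∑ p ∈ 𝓟, (1 / p : ℝ))| * 1 :=
        mul_le_mul_of_nonneg_left (hG n) (abs_nonneg _)
    _ = _ := mul_one _

/-! ## Step 2: grouping by the prime, `∑ ω G = ∑_p ∑_{m < ⌈N/p⌉} G(pm)` -/

/-- `∑_{n<N} ω(n) G(n) = ∑_{p ∈ 𝓟} ∑_{m < ⌈N/p⌉} G(pm)`. [cite: Katai1986, proof of the Theorem] -/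
theorem sum_omega_mul_eq (𝓟 : Finset ℕ) (h𝓟 : ∀ p ∈ 𝓟, p.Prime) (G : ℕ → ℂ) (N : ℕ) :
    ∑ n ∈ range N, ((#(𝓟.filter (· ∣ n)) : ℝ) : ℂ) * G n =
      ∑ p ∈ 𝓟, ∑ m ∈ range ((N + p - 1) / p), G (p * m) := by
  have h1 : ∀ n : ℕ, ((#(𝓟.filter (· ∣ n)) : ℝ) : ℂ) * G n =
      ∑ p ∈ 𝓟, (if p ∣ n then G n else 0) := by
    intro n
    rw [natCast_card_filter]
    push_cast
    rw [sum_mul]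
    refine sum_congr rfl fun p _ => ?_
    split_ifs <;> simp
  simp_rw [h1]
  rw [sum_comm]
  refine sum_congr rfl fun p hp => ?_
  rw [← sum_filter, sum_filter_dvd_eq G (h𝓟 p hp).pos]

/-! ## Step 3: `ν(pm) = ν(p) ν(m)` off the multiples of `p²` -/

/-- `‖∑_p ∑_{m<⌈N/p⌉} F(pm) ν(pm) - ∑_p ∑_{m<⌈N/p⌉} ν(p) ν(m) F(pm)‖ ≤ 2NA/P₁ + 4P` when all
`p ∈ 𝓟` are primes `> P₁ ≥ 1`. [cite: Katai1986, proof of the Theorem] -/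
theorem norm_sum_sub_bilinear_le (𝓟 : Finset ℕ) (h𝓟 : ∀ p ∈ 𝓟, p.Prime) {P₁ : ℕ} (hP₁ : 0 < P₁)
    (h𝓟P : ∀ p ∈ 𝓟, P₁ < p) {F ν : ℕ → ℂ} (hF : ∀ n, ‖F n‖ ≤ 1) (hν1 : ∀ n, ‖ν n‖ ≤ 1)
    (hν : ∀ p m : ℕ, p.Prime → ¬ p ∣ m → ν (p * m) = ν p * ν m) (N : ℕ) :
    ‖∑ p ∈ 𝓟, ∑ m ∈ range ((N + p - 1) / p), F (p * m) * ν (p * m) -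
        ∑ p ∈ 𝓟, ∑ m ∈ range ((N + p - 1) / p), ν p * ν m * F (p * m)‖ ≤
      2 * N * (∑ p ∈ 𝓟, (1 / p : ℝ)) / P₁ + 4 * #𝓟 := by
  rw [← sum_sub_distrib]
  refine (norm_sum_le _ _).trans ?_
  have hP₁r : (0 : ℝ) < P₁ := by exact_mod_cast hP₁
  have hper : ∀ p ∈ 𝓟, ‖∑ m ∈ range ((N + p - 1) / p), F (p * m) * ν (p * m) -
      ∑ m ∈ range ((N + p - 1) / p), ν p * ν m * F (p * m)‖ ≤
      2 * N / P₁ * (1 / p : ℝ) + 4 := by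
    intro p hp
    have hpp : p.Prime := h𝓟 p hp
    have hp0 : 0 < p := hpp.pos
    have hpr : (0 : ℝ) < p := by exact_mod_cast hp0
    rw [← sum_sub_distrib]
    refine (norm_sum_le _ _).trans ?_
    -- each term vanishes unless `p ∣ m`, and is `≤ 2` otherwise
    have hterm : ∀ m : ℕ, ‖F (p * m) * ν (p * m) - ν p * ν m * F (p * m)‖ ≤
        if p ∣ m then (2 : ℝ) else 0 := by
      intro m
      split_ifs with h
      · calc ‖F (p * m) * ν (p * m) - ν p * ν m * F (p * m)‖
            ≤ ‖F (p * m) * ν (p * m)‖ + ‖ν p * ν m * F (p * m)‖ := norm_sub_le _ _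
          _ ≤ 1 + 1 := by
              refine add_le_add ?_ ?_
              · rw [norm_mul]
                calc ‖F (p * m)‖ * ‖ν (p * m)‖ ≤ 1 * 1 :=
                    mul_le_mul (hF _) (hν1 _) (norm_nonneg _) zero_le_one
                  _ = 1 := one_mul _
              · rw [norm_mul, norm_mul]
                calc ‖ν p‖ * ‖ν m‖ * ‖F (p * m)‖ ≤ 1 * 1 * 1 := by
                      refine mul_le_mul (mul_le_mul (hν1 _) (hν1 _) (norm_nonneg _)
                        zero_le_one) (hF _) (norm_nonneg _) (by norm_num)
                  _ = 1 := by norm_num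
          _ = 2 := by norm_num
      · rw [hν p m hpp h]
        have : F (p * m) * (ν p * ν m) - ν p * ν m * F (p * m) = 0 := by ring
        rw [this, norm_zero]
    calc ∑ m ∈ range ((N + p - 1) / p), ‖F (p * m) * ν (p * m) - ν p * ν m * F (p * m)‖
        ≤ ∑ m ∈ range ((N + p - 1) / p), (if p ∣ m then (2 : ℝ) else 0) :=
          sum_le_sum fun m _ => hterm m
      _ = 2 * #((range ((N + p - 1) / p)).filter (p ∣ ·)) := by
          rw [← sum_filter, sum_const, nsmul_eq_mul, mul_comm]
      _ ≤ 2 * ((((N + p - 1) / p : ℕ) : ℝ) / p + 1) := by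
          gcongr
          exact card_filter_dvd_le hp0 _
      _ ≤ 2 * ((N / p + 1) / p + 1) := by
          gcongr
          exact ceilDiv_le_real hp0 N
      _ = 2 * N * (1 / p * (1 / p)) + 2 * (1 / p) + 2 := by
          field_simp
      _ ≤ 2 * N * (1 / P₁ * (1 / p)) + 2 * 1 + 2 := by
          have h1 : (1 / p : ℝ) ≤ 1 / P₁ :=
            one_div_le_one_div_of_le hP₁r (by exact_mod_cast (h𝓟P p hp).le)
          have h2 : (1 / p : ℝ) ≤ 1 := by
            rw [div_le_one hpr]; exact_mod_cast hp0
          have h3 : (0 : ℝ) ≤ 1 / p := by positivity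
          have hN : (0 : ℝ) ≤ N := by positivity
          gcongr
      _ = 2 * N / P₁ * (1 / p : ℝ) + 4 := by ring
  calc ∑ p ∈ 𝓟, ‖∑ m ∈ range ((N + p - 1) / p), F (p * m) * ν (p * m) -
          ∑ m ∈ range ((N + p - 1) / p), ν p * ν m * F (p * m)‖
      ≤ ∑ p ∈ 𝓟, (2 * N / P₁ * (1 / p : ℝ) + 4) := sum_le_sum hper
    _ = 2 * N * (∑ p ∈ 𝓟, (1 / p : ℝ)) / P₁ + 4 * #𝓟 := by
        rw [sum_add_distrib, sum_const, nsmul_eq_mul, ← mul_sum]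
        ring

/-! ## Step 4: Cauchy–Schwarz in the cofactor and the bilinear expansion -/

/-- `range ⌈N/p⌉` is the set of `m < N` with `pm < N` (`p ≥ 1`). [folklore] -/
theorem filter_mul_lt_eq_range {p : ℕ} (hp : 0 < p) (N : ℕ) :
    (range N).filter (fun m => p * m < N) = range ((N + p - 1) / p) := by
  ext m
  simp only [mem_filter, mem_range, lt_ceilDiv_iff hp]
  constructor
  · exact fun h => h.2
  · intro h
    refine ⟨lt_of_le_of_lt ?_ h, h⟩
    exact Nat.le_mul_of_pos_left m hp

/-- The Cauchy–Schwarz / bilinear bound for `T = ∑_p ∑_{m<⌈N/p⌉} ν(p) ν(m) F(pm)`: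
if `‖∑_{m<N, pm<N, p'm<N} F(pm) conj F(p'm)‖ ≤ η N` for all `p ≠ p'` in `𝓟` then
`‖T‖ ≤ √(N (NA + P + P² η N))`. [cite: Katai1986, proof of the Theorem] -/
theorem norm_bilinear_le (𝓟 : Finset ℕ) (h𝓟 : ∀ p ∈ 𝓟, p.Prime) {F ν : ℕ → ℂ}
    (hF : ∀ n, ‖F n‖ ≤ 1) (hν1 : ∀ n, ‖ν n‖ ≤ 1) (N : ℕ) {η : ℝ} (hη : 0 ≤ η)
    (hcorr : ∀ p ∈ 𝓟, ∀ p' ∈ 𝓟, p ≠ p' →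
      ‖∑ m ∈ (range N).filter (fun m => p * m < N ∧ p' * m < N),
          F (p * m) * conj (F (p' * m))‖ ≤ η * N) :
    ‖∑ p ∈ 𝓟, ∑ m ∈ range ((N + p - 1) / p), ν p * ν m * F (p * m)‖ ≤
      Real.sqrt (N * (N * (∑ p ∈ 𝓟, (1 / p : ℝ)) + #𝓟 + (#𝓟 : ℝ) ^ 2 * η * N)) := by
  -- the coefficients `c p m = [pm < N] ν(p) F(pm)` and `b m = ∑_p c p m`
  set c : ℕ → ℕ → ℂ := fun p m => if p * m < N then ν p * F (p * m) else 0 with hc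
  set b : ℕ → ℂ := fun m => ∑ p ∈ 𝓟, c p m with hb
  -- rewrite `T = ∑_{m<N} ν(m) b(m)`
  have hT : ∑ p ∈ 𝓟, ∑ m ∈ range ((N + p - 1) / p), ν p * ν m * F (p * m) =
      ∑ m ∈ range N, ν m * b m := by
    have h1 : ∀ p ∈ 𝓟, ∑ m ∈ range ((N + p - 1) / p), ν p * ν m * F (p * m) =
        ∑ m ∈ range N, ν m * c p m := by
      intro p hp
      rw [← filter_mul_lt_eq_range (h𝓟 p hp).pos, sum_filter]
      refine sum_congr rfl fun m _ => ?_
      simp only [hc]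
      split_ifs <;> ring
    rw [sum_congr rfl h1, sum_comm]
    refine sum_congr rfl fun m _ => ?_
    rw [hb, mul_sum]
  rw [hT]
  -- Cauchy–Schwarz with the weights `1`
  have hCS : ‖∑ m ∈ range N, ν m * b m‖ ^ 2 ≤ N * ∑ m ∈ range N, ‖b m‖ ^ 2 := by
    have h1 : ‖∑ m ∈ range N, ν m * b m‖ ≤ ∑ m ∈ range N, 1 * ‖b m‖ := by
      refine (norm_sum_le _ _).trans (sum_le_sum fun m _ => ?_)
      rw [norm_mul]
      exact mul_le_mul_of_nonneg_right (hν1 m) (norm_nonneg _)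
    have h2 := sum_mul_sq_le_sq_mul_sq (range N) (fun _ => (1 : ℝ)) (fun m => ‖b m‖)
    simp only [one_pow, sum_const, card_range, nsmul_eq_mul, mul_one] at h2
    calc ‖∑ m ∈ range N, ν m * b m‖ ^ 2 ≤ (∑ m ∈ range N, 1 * ‖b m‖) ^ 2 := by
          gcongr
      _ ≤ N * ∑ m ∈ range N, ‖b m‖ ^ 2 := h2
  -- expansion of `‖b m‖²`
  have hb2 : ∀ m : ℕ, ‖b m‖ ^ 2 = (∑ p ∈ 𝓟, ∑ p' ∈ 𝓟, c p m * conj (c p' m)).re := by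
    intro m
    rw [← sum_mul_sum, ← map_sum, Complex.mul_conj, Complex.ofReal_re, Complex.normSq_eq_norm_sq]
  -- the pairwise sums
  have hpt : ∀ p p' m : ℕ, c p m * conj (c p' m) =
      if p * m < N ∧ p' * m < N then ν p * conj (ν p') * (F (p * m) * conj (F (p' * m)))
      else 0 := by
    intro p p' m
    simp only [hc]
    by_cases h1 : p * m < N <;> by_cases h2 : p' * m < N <;> simp [h1, h2, map_mul]
    ring
  have hpair : ∀ p ∈ 𝓟, ∀ p' ∈ 𝓟, ‖∑ m ∈ range N, c p m * conj (c p' m)‖ ≤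
      if p = p' then (N / p + 1 : ℝ) else η * N := by
    intro p hp p' hp'
    simp_rw [hpt p p']
    rw [← sum_filter, ← mul_sum, norm_mul]
    have hνν : ‖ν p * conj (ν p')‖ ≤ 1 := by
      rw [norm_mul, Complex.norm_conj]
      calc ‖ν p‖ * ‖ν p'‖ ≤ 1 * 1 := mul_le_mul (hν1 _) (hν1 _) (norm_nonneg _) zero_le_one
        _ = 1 := one_mul _
    refine (mul_le_mul_of_nonneg_right hνν (norm_nonneg _)).trans ?_
    rw [one_mul]
    split_ifs with hpp
    · subst hpp
      calc ‖∑ m ∈ (range N).filter (fun m => p * m < N ∧ p * m < N),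
              F (p * m) * conj (F (p * m))‖
          ≤ ∑ m ∈ (range N).filter (fun m => p * m < N ∧ p * m < N),
              ‖F (p * m) * conj (F (p * m))‖ := norm_sum_le _ _
        _ ≤ ∑ m ∈ (range N).filter (fun m => p * m < N ∧ p * m < N), (1 : ℝ) := by
            refine sum_le_sum fun m _ => ?_
            rw [norm_mul, Complex.norm_conj]
            calc ‖F (p * m)‖ * ‖F (p * m)‖ ≤ 1 * 1 :=
                mul_le_mul (hF _) (hF _) (norm_nonneg _) zero_le_one
              _ = 1 := one_mul _
        _ = #((range N).filter (fun m => p * m < N ∧ p * m < N)) := by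
            rw [sum_const, nsmul_eq_mul, mul_one]
        _ ≤ #(range ((N + p - 1) / p)) := by
            gcongr
            rw [← filter_mul_lt_eq_range (h𝓟 p hp).pos]
            exact monotone_filter_right _ fun m _ hm => hm.1
        _ ≤ N / p + 1 := by
            rw [card_range]; exact ceilDiv_le_real (h𝓟 p hp).pos N
    · exact hcorr p hp p' hp' hpp
  -- sum over `m`
  have hsum : ∑ m ∈ range N, ‖b m‖ ^ 2 ≤
      N * (∑ p ∈ 𝓟, (1 / p : ℝ)) + #𝓟 + (#𝓟 : ℝ) ^ 2 * η * N := by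
    simp_rw [hb2]
    rw [← Complex.re_sum, sum_comm]
    simp_rw [sum_comm (s := range N)]
    calc (∑ p ∈ 𝓟, ∑ p' ∈ 𝓟, ∑ m ∈ range N, c p m * conj (c p' m)).re
        ≤ ‖∑ p ∈ 𝓟, ∑ p' ∈ 𝓟, ∑ m ∈ range N, c p m * conj (c p' m)‖ := Complex.re_le_norm _
      _ ≤ ∑ p ∈ 𝓟, ∑ p' ∈ 𝓟, ‖∑ m ∈ range N, c p m * conj (c p' m)‖ := by
          refine (norm_sum_le _ _).trans (sum_le_sum fun p _ => norm_sum_le _ _)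
      _ ≤ ∑ p ∈ 𝓟, ∑ p' ∈ 𝓟, (if p = p' then (N / p + 1 : ℝ) else η * N) :=
          sum_le_sum fun p hp => sum_le_sum fun p' hp' => hpair p hp p' hp'
      _ ≤ ∑ p ∈ 𝓟, ((N / p + 1 : ℝ) + ∑ p' ∈ 𝓟, η * N) := by
          refine sum_le_sum fun p hp => ?_
          rw [← Finset.add_sum_erase 𝓟 _ hp, if_pos rfl]
          refine add_le_add le_rfl ?_
          calc ∑ p' ∈ 𝓟.erase p, (if p = p' then (N / p + 1 : ℝ) else η * N)
              = ∑ p' ∈ 𝓟.erase p, η * N := by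
                refine sum_congr rfl fun p' hp' => ?_
                rw [mem_erase] at hp'
                rw [if_neg (Ne.symm hp'.1)]
            _ ≤ ∑ p' ∈ 𝓟, η * N := by
                refine sum_le_sum_of_subset_of_nonneg (erase_subset _ _) fun _ _ _ => ?_
                positivity
      _ = N * (∑ p ∈ 𝓟, (1 / p : ℝ)) + #𝓟 + (#𝓟 : ℝ) ^ 2 * η * N := by
          rw [sum_add_distrib, sum_add_distrib, sum_const, sum_const, sum_const, nsmul_eq_mul,
            nsmul_eq_mul, nsmul_eq_mul, mul_sum]
          have : ∀ p ∈ 𝓟, (N / p : ℝ) = N * (1 / p) := fun p _ => by ring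
          rw [sum_congr rfl this]
          ring
  refine Real.le_sqrt_of_sq_le (hCS.trans ?_)
  gcongr

/-! ## The inequality at fixed length -/

/-- **Kátai's inequality at a fixed length** (Kátai 1986; Konieczny 2020, Theorem 2.1, proof).
Let `𝓟` be a finite set of primes all `> P₁ ≥ 1`, `A = ∑_{p∈𝓟} 1/p`, `P = #𝓟`; let
`F, ν : ℕ → ℂ` be `1`-bounded with `ν(pm) = ν(p)ν(m)` for primes `p ∤ m`; let `η ≥ 0` with
`‖∑_{m<N, pm<N, p'm<N} F(pm) conj F(p'm)‖ ≤ η N` for all `p ≠ p'` in `𝓟`.  Then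
`A ‖∑_{n<N} F(n) ν(n)‖ ≤ √(N(2NA + 4P²)) + (2NA/P₁ + 4P) + √(N(NA + P + P² η N))`.
[cite: Katai1986, Theorem] -/
theorem katai_fixed_length (𝓟 : Finset ℕ) (h𝓟 : ∀ p ∈ 𝓟, p.Prime) {P₁ : ℕ} (hP₁ : 0 < P₁)
    (h𝓟P : ∀ p ∈ 𝓟, P₁ < p) {F ν : ℕ → ℂ} (hF : ∀ n, ‖F n‖ ≤ 1) (hν1 : ∀ n, ‖ν n‖ ≤ 1)
    (hν : ∀ p m : ℕ, p.Prime → ¬ p ∣ m → ν (p * m) = ν p * ν m) (N : ℕ) {η : ℝ} (hη : 0 ≤ η)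
    (hcorr : ∀ p ∈ 𝓟, ∀ p' ∈ 𝓟, p ≠ p' →
      ‖∑ m ∈ (range N).filter (fun m => p * m < N ∧ p' * m < N),
          F (p * m) * conj (F (p' * m))‖ ≤ η * N) :
    (∑ p ∈ 𝓟, (1 / p : ℝ)) * ‖∑ n ∈ range N, F n * ν n‖ ≤
      Real.sqrt (N * (2 * N * (∑ p ∈ 𝓟, (1 / p : ℝ)) + 4 * (#𝓟 : ℝ) ^ 2)) +
        (2 * N * (∑ p ∈ 𝓟, (1 / p : ℝ)) / P₁ + 4 * #𝓟) +
        Real.sqrt (N * (N * (∑ p ∈ 𝓟, (1 / p : ℝ)) + #𝓟 + (#𝓟 : ℝ) ^ 2 * η * N)) := by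
  set A : ℝ := ∑ p ∈ 𝓟, (1 / p : ℝ) with hA
  have hFν : ∀ n, ‖F n * ν n‖ ≤ 1 := fun n => by
    rw [norm_mul]
    calc ‖F n‖ * ‖ν n‖ ≤ 1 * 1 := mul_le_mul (hF n) (hν1 n) (norm_nonneg _) zero_le_one
      _ = 1 := one_mul _
  have h1 := norm_A_mul_sum_sub_le 𝓟 h𝓟 hFν N
  have h2 := sum_omega_mul_eq 𝓟 h𝓟 (fun n => F n * ν n) N
  have h3 := norm_sum_sub_bilinear_le 𝓟 h𝓟 hP₁ h𝓟P hF hν1 hν N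
  have h4 := norm_bilinear_le 𝓟 h𝓟 hF hν1 N hη hcorr
  rw [← hA] at h1 h3 h4
  have hA0 : 0 ≤ A := sum_nonneg fun p _ => by positivity
  have hnorm : A * ‖∑ n ∈ range N, F n * ν n‖ = ‖(A : ℂ) * ∑ n ∈ range N, F n * ν n‖ := by
    rw [norm_mul, Complex.norm_real, Real.norm_eq_abs, abs_of_nonneg hA0]
  rw [hnorm]
  set X := (A : ℂ) * ∑ n ∈ range N, F n * ν n
  set Y := ∑ n ∈ range N, ((#(𝓟.filter (· ∣ n)) : ℝ) : ℂ) * (F n * ν n)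
  set Z := ∑ p ∈ 𝓟, ∑ m ∈ range ((N + p - 1) / p), F (p * m) * ν (p * m)
  set T := ∑ p ∈ 𝓟, ∑ m ∈ range ((N + p - 1) / p), ν p * ν m * F (p * m)
  have hYZ : Y = Z := h2
  calc ‖X‖ = ‖(X - Y) + (Z - T) + T‖ := by rw [hYZ]; ring_nf
    _ ≤ ‖X - Y‖ + ‖Z - T‖ + ‖T‖ := norm_add₃_le
    _ ≤ _ := add_le_add (add_le_add h1 h3) h4

end Konieczny

end Literature.NumberTheory.LFunctions
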